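import Summits.BirchSwinnertonDyer.BirchSwinnertonDyer.Theorems.PrintCf2SplitBadTwoCMEndomorphismSqrtMinusSeven
import Literature.NumberTheory.EllipticCurves.KubertTwoTwelve
import Literature.NumberTheory.EllipticCurves.TwoDescent
import Literature.NumberTheory.EllipticCurves.IsogenyBaseChange
import Literature.NumberTheory.EllipticCurves.GaloisAction
import Mathlib.FieldTheory.Galois.Infinite
import HarnessLib

/-!
# Crux `PrintCf2.SplitBadTwoRankOneOfFacts` (item stmt-BirchSwinnertonDyer-20368), road α over the CM field:
# 2-TORSION RIGIDITY of the complex multiplication — over ANY field `F ∌ √−7` of characteristic `0` the CM endomorphism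
# `π = [(1+√−7)/2]` of a `j = −3375` curve is NOT `Γ_F`-equivariant (so an element moving `√−7` conjugates `π` to `π̄`)

Cell `bsd-print-cf2`, width seat `bsd-line-cf2-p1-w8` g0 (brick **B6e-ii**: the local non-rationality input of the Ш local descent,
memo `Cruxes/SplitBadTwoRankOneOfFacts/SHA-CM-DESCENT-w8g0.md` §«What is missing» (ii)); `--supports stmt-BirchSwinnertonDyer-20368`
(helper). HONEST FRAMING: nothing here closes a crux or a stub; BSD is not proved by any of this; no summit statement is proved by
this seat. No definition is introduced. beyond-print theorem: no.

THE ARGUMENT (no tangent space, no `p`-adic input). `π π̄ = 2`, so `ker π = {0, T}`, `ker π̄ = {0, T'}` are pairs of `2`-torsion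
points with `T ≠ T'`; if `π` commuted with `Γ_F` both pairs would be `Γ_F`-stable, so `T`, `T'`, `T + T'` — ALL of `E[2]` — would be
`Γ_F`-fixed; then the `2`-division cubic splits over `F̄` with `Γ_F`-fixed roots (the tree's `KubertTwoTwelve.splitTwoTorsion_of_two_smul`)
and `Δ = 16·∏(eᵢ − eⱼ)²` (`SplitTwoTorsion.Δ_eq`) is the square of a `Γ_F`-fixed element, i.e. of an element of `F`
(`InfiniteGalois.mem_range_algebraMap_iff_fixed`). But for `j = −3375`: `c₄³ = jΔ = −3375Δ` and `1728Δ = c₄³ − c₆²` give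
`Δ = −c₆²/5103 = −7·(c₆/189)²` (`Δ_eq_neg_seven_mul_sq_of_j_eq`), so `−7` would be a square in `F`.

* §1 `Δ_eq_neg_seven_mul_sq_of_j_eq` (any `ℚ`-algebra field), `isSquare_Δ_of_splitTwoTorsion`.
* §2 **`isSquare_neg_seven_of_cmEndo_equivariant`** (`W/ℚ` elliptic, `j = −3375`, `F` a field of characteristic `0`, `π` on
  `E_F(F̄)` with `π² = π − 2`, `#ker π = #ker π̄ = 2`, `Γ_F`-equivariant ⟹ `IsSquare (−7 : F)`).
* §3 **`smul_cmEndo_eq_of_coset_of_not_isSquare`**: for `F` with `¬ IsSquare (−7 : F)` (e.g. `ℚ_v`, `v` inert or ramified in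
  `ℚ(√−7)`), `π ∈ End_{F̄}(E_F)` with the above data, a subgroup `N ≤ Γ_F` commuting with `π` and `g₀` with `Γ_F = N ∪ N g₀`:
  `g₀ • π P = g₀ • P − π (g₀ • P)` — the `F`-general form of p652052's `smul_cmEndo_eq_of_coset` (there `F = ℚ`, via `End_ℚ(E) = ℤ`).

References: [SilvermanAEC2009] III.§1 (`c₄, c₆, Δ, j`), Prop. X.1.4 (`E[2] ⊆ E(K)`); [SilvermanATAEC1994] II §2 Thm. 2.2(b);
J.-P. Serre, *Galois Cohomology*, II.§1 (fixed points).
-/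

noncomputable section

open scoped Classical

set_option linter.dupNamespace false
set_option autoImplicit false

namespace Summit.BirchSwinnertonDyer.BirchSwinnertonDyer.Theorems.PrintCf2.CMPrimes

open WeierstrassCurve Literature.NumberTheory.EllipticCurves Field

/-! ## §1 `Δ = −7·(c₆/189)²` for `j = −3375`; a split `2`-division cubic makes `Δ` a square -/

section Delta

variable {F : Type*} [Field F] [CharZero F]

/-- **`Δ = −7·(c₆/189)²` for `j = −3375`** (any field of characteristic `0`): from `j = c₄³/Δ` and `1728Δ = c₄³ − c₆²`,
`c₆² = −5103Δ = −7·27²·Δ`. In particular `Δ ≡ −7` modulo squares and `ℚ(E[2]) = ℚ(√Δ) = ℚ(√−7)` for every `ℚ`-model with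
`j = −3375`. [cite: SilvermanAEC2009, III.§1 (c₄, c₆, Δ, j)] -/
theorem Δ_eq_neg_seven_mul_sq_of_j_eq (V : WeierstrassCurve F) [V.IsElliptic] (hj : V.j = -3375) :
    V.Δ = -7 * (V.c₆ / 189) ^ 2 := by
  have h1 : (V.Δ' : F) * ↑V.Δ'⁻¹ = 1 := Units.mul_inv V.Δ'
  have hc4 : V.c₄ ^ 3 = V.Δ * V.j := by
    rw [WeierstrassCurve.j, ← mul_assoc, ← coe_Δ', h1, one_mul]
  rw [hj] at hc4
  have hrel := V.c_relation
  field_simp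
  linear_combination 7 * hrel + 7 * hc4

/-- `c₆ ≠ 0` for `j = −3375` (else `Δ = 0`). [cite: SilvermanAEC2009, III.§1 (c₄, c₆, Δ, j)] -/
theorem c₆_ne_zero_of_j_eq (V : WeierstrassCurve F) [V.IsElliptic] (hj : V.j = -3375) : V.c₆ ≠ 0 := by
  intro h0
  have h := Δ_eq_neg_seven_mul_sq_of_j_eq V hj
  rw [h0, zero_div, zero_pow two_ne_zero, mul_zero] at h
  exact V.Δ'.ne_zero (by rw [coe_Δ', h])

omit [CharZero F] in
/-- A split `2`-division cubic makes `Δ` a square: `Δ = (4(e₁ − e₂)(e₁ − e₃)(e₂ − e₃))²` (`SplitTwoTorsion.Δ_eq`). [folklore] -/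
theorem isSquare_Δ_of_splitTwoTorsion {V : Affine F} {e₁ e₂ e₃ : F} (h : V.SplitTwoTorsion e₁ e₂ e₃) :
    ∃ δ : F, V.Δ = δ ^ 2 ∧ δ = 4 * ((e₁ - e₂) * (e₁ - e₃) * (e₂ - e₃)) :=
  ⟨4 * ((e₁ - e₂) * (e₁ - e₃) * (e₂ - e₃)), by rw [h.Δ_eq]; ring, rfl⟩

end Delta

/-! ## §2 A `Γ_F`-equivariant CM endomorphism forces `√−7 ∈ F` -/

section Rigidity

variable (W : WeierstrassCurve ℚ) [W.IsElliptic] (F : Type) [Field F] [CharZero F]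

omit [CharZero F] in
/-- Pointwise `π(πP) = πP − 2P` gives `π(P − πP) = 2P`: so `ker π ⊆ E[2]` and `ker(1 − π) ⊆ E[2]`. [folklore] -/
theorem two_smul_eq_zero_of_cmEndo {V : WeierstrassCurve F} {π : AddMonoid.End V.geomPoints} (hrel : π * π = π - 2)
    {P : V.geomPoints} (hP : π P = 0 ∨ π P = P) : (2 : ℤ) • P = 0 := by
  have h2 : π (P - π P) = (2 : ℕ) • P := by
    rw [map_sub, cmEndo_apply_apply V hrel P, sub_sub_cancel]
  rcases hP with h | h
  · rw [h, sub_zero, h] at h2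
    rw [← natCast_zsmul] at h2; exact_mod_cast h2.symm
  · rw [h, sub_self, map_zero] at h2
    rw [← natCast_zsmul] at h2; exact_mod_cast h2.symm

/-- **`Γ_F`-EQUIVARIANCE OF `π` FORCES `√−7 ∈ F`.** `E = W/ℚ` elliptic with `j = −3375`, `F` a field of characteristic `0`,
`π` an endomorphism of `E_F(F̄)` with `π² = π − 2` and `#ker π = #ker(1 − π) = 2` (the complex multiplication `[(1+√−7)/2]`). If
`π(σP) = σ(πP)` for all `σ ∈ Γ_F`, then `−7` is a square in `F`. [cite: SilvermanAEC2009, Prop. X.1.4 and III.§1]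
[cite: SilvermanATAEC1994, II §2 Thm. 2.2(b) and App. A §3 (row D = -7)] -/
theorem isSquare_neg_seven_of_cmEndo_equivariant (hj : W.j = -3375) {π : AddMonoid.End (W.baseChange F).geomPoints}
    (hrel : π * π = π - 2)
    (hker : Nat.card (π : (W.baseChange F).geomPoints →+ (W.baseChange F).geomPoints).ker = 2)
    (hker' : Nat.card ((1 - π : AddMonoid.End (W.baseChange F).geomPoints) :
      (W.baseChange F).geomPoints →+ (W.baseChange F).geomPoints).ker = 2)
    (hπG : ∀ (σ : absoluteGaloisGroup F) (P : (W.baseChange F).geomPoints), π (σ • P) = σ • π P) :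
    IsSquare (-7 : F) := by
  haveI : IsGalois F (AlgebraicClosure F) := {}
  haveI : (W.baseChange F).IsElliptic := inferInstanceAs ((W.map (algebraMap ℚ F)).IsElliptic)
  -- `(1 - π) P = P - π P`
  have h1π : ∀ P : (W.baseChange F).geomPoints, (1 - π : AddMonoid.End (W.baseChange F).geomPoints) P = P - π P := fun P ↦ by
    change ((1 : AddMonoid.End (W.baseChange F).geomPoints) : _ →+ _) P - (π : _ →+ _) P = _
    simp
  -- non-zero elements `T ∈ ker π`, `T' ∈ ker (1 - π)` and the structure of the two kernels
  have hker2 : ∀ {G : AddSubgroup (W.baseChange F).geomPoints}, Nat.card G = 2 →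
      ∃ T : (W.baseChange F).geomPoints, T ∈ G ∧ T ≠ 0 ∧ ∀ S ∈ G, S = 0 ∨ S = T := by
    intro G hG
    obtain ⟨a, b, hab, huniv⟩ := Nat.card_eq_two_iff.mp hG
    have hmem : ∀ S : G, S = a ∨ S = b := fun S ↦ by
      have : S ∈ ({a, b} : Set G) := huniv ▸ Set.mem_univ S
      simpa using this
    by_cases ha : (a : (W.baseChange F).geomPoints) = 0
    · refine ⟨b, b.2, fun hb ↦ hab (Subtype.ext (ha.trans hb.symm)), fun S hS ↦ ?_⟩
      rcases hmem ⟨S, hS⟩ with h | h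
      · exact Or.inl ((congrArg Subtype.val h).trans ha)
      · exact Or.inr (congrArg Subtype.val h)
    · refine ⟨a, a.2, ha, fun S hS ↦ ?_⟩
      rcases hmem ⟨S, hS⟩ with h | h
      · exact Or.inr (congrArg Subtype.val h)
      · -- `S = b`; then `a` is `0` or `b`… use `0 ∈ G`
        rcases hmem ⟨0, G.zero_mem⟩ with h0 | h0
        · exact absurd (congrArg Subtype.val h0).symm ha
        · exact Or.inl ((congrArg Subtype.val h).trans (congrArg Subtype.val h0).symm)
  obtain ⟨T, hT, hT0, hTuniq⟩ := hker2 hker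
  obtain ⟨T', hT', hT'0, hT'uniq⟩ := hker2 hker'
  rw [AddMonoidHom.mem_ker] at hT hT'
  change π T = 0 at hT
  change (1 - π : AddMonoid.End (W.baseChange F).geomPoints) T' = 0 at hT'
  rw [h1π, sub_eq_zero] at hT'
  -- `Γ_F` fixes `T` and `T'`
  have hfixT : ∀ σ : absoluteGaloisGroup F, σ • T = T := fun σ ↦ by
    have hmem : σ • T ∈ (π : (W.baseChange F).geomPoints →+ (W.baseChange F).geomPoints).ker := by
      rw [AddMonoidHom.mem_ker]; change π (σ • T) = 0; rw [hπG, hT, smul_zero]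
    rcases hTuniq _ hmem with h | h
    · exact absurd ((smul_eq_zero_iff_eq σ).mp h) hT0
    · exact h
  have hfixT' : ∀ σ : absoluteGaloisGroup F, σ • T' = T' := fun σ ↦ by
    have hmem : σ • T' ∈ ((1 - π : AddMonoid.End (W.baseChange F).geomPoints) : (W.baseChange F).geomPoints →+ (W.baseChange F).geomPoints).ker := by
      rw [AddMonoidHom.mem_ker]
      change (1 - π : AddMonoid.End (W.baseChange F).geomPoints) (σ • T') = 0
      rw [h1π, hπG, ← hT', sub_self]
    rcases hT'uniq _ hmem with h | h
    · exact absurd ((smul_eq_zero_iff_eq σ).mp h) hT'0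
    · exact h
  -- `2`-torsion, distinctness
  have h2T : (2 : ℤ) • T = 0 := two_smul_eq_zero_of_cmEndo F hrel (Or.inl hT)
  have h2T' : (2 : ℤ) • T' = 0 := two_smul_eq_zero_of_cmEndo F hrel (Or.inr hT'.symm)
  have hTT' : T ≠ T' := fun h ↦ hT'0 (by rw [hT', ← h, hT])
  have h2T'' : (2 : ℤ) • (T + T') = 0 := by rw [smul_add, h2T, h2T', add_zero]
  have hT''0 : T + T' ≠ 0 := fun h ↦ by
    have : T = -T' := eq_neg_of_add_eq_zero_left h
    have hneg : -T' = T' := by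
      rw [neg_eq_iff_add_eq_zero, ← two_smul ℤ, h2T']
    exact hTT' (this.trans hneg)
  have hT''T : T + T' ≠ T := fun h ↦ hT'0 (by simpa using h)
  have hT''T' : T + T' ≠ T' := fun h ↦ hT0 (by simpa using h)
  -- the three points as affine points of `E` over `F̄`
  have haff : ∀ {P : (W.baseChange F).geomPoints}, P ≠ 0 →
      ∃ (x y : AlgebraicClosure F) (h : ((W.baseChange F).baseChange (AlgebraicClosure F)).toAffine.Nonsingular x y),
        P = (Affine.Point.some x y h : ((W.baseChange F).baseChange (AlgebraicClosure F)).toAffine.Point) := by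
    intro P hP
    change ((W.baseChange F).baseChange (AlgebraicClosure F)).toAffine.Point at P
    rcases P with _ | ⟨x, y, h⟩
    · exact absurd rfl hP
    · exact ⟨x, y, h, rfl⟩
  obtain ⟨x₁, y₁, h₁, e₁⟩ := haff hT0
  obtain ⟨x₂, y₂, h₂, e₂⟩ := haff hT'0
  obtain ⟨x₃, y₃, h₃, e₃⟩ := haff hT''0
  -- fixed coordinates
  have hfixX : ∀ {P : (W.baseChange F).geomPoints} {x y : AlgebraicClosure F}
      {h : ((W.baseChange F).baseChange (AlgebraicClosure F)).toAffine.Nonsingular x y},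
      P = (Affine.Point.some x y h : ((W.baseChange F).baseChange (AlgebraicClosure F)).toAffine.Point) →
      (∀ σ : absoluteGaloisGroup F, σ • P = P) → ∀ f : AlgebraicClosure F ≃ₐ[F] AlgebraicClosure F, f x = x := by
    intro P x y h e hfix f
    have hσ := hfix ((absoluteGaloisGroup.toAlgEquiv F).symm f)
    rw [e] at hσ
    change Affine.Point.map (W' := W.baseChange F)
      ((f : AlgebraicClosure F ≃ₐ[F] AlgebraicClosure F) : AlgebraicClosure F →ₐ[F] AlgebraicClosure F)
      (Affine.Point.some x y h) = Affine.Point.some x y h at hσ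
    rw [Affine.Point.map_some] at hσ
    have hσ' := hσ
    simp only [Affine.Point.some.injEq, AlgEquiv.coe_toAlgHom] at hσ'
    simpa using hσ'.1
  have hx₁ := hfixX e₁ hfixT
  have hx₂ := hfixX e₂ hfixT'
  have hx₃ := hfixX e₃ (fun σ ↦ by rw [smul_add, hfixT, hfixT'])
  -- the `2`-division cubic of `E` over `F̄` splits at `x₁, x₂, x₃`
  have hsplit : ((W.baseChange F).baseChange (AlgebraicClosure F)).toAffine.SplitTwoTorsion x₁ x₂ x₃ := by
    refine KubertTwoTwelve.splitTwoTorsion_of_two_smul (W := ((W.baseChange F).baseChange (AlgebraicClosure F)).toAffine)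
      (h₁ := h₁) (h₂ := h₂) (h₃ := h₃) ?_ ?_ ?_ ?_ ?_ ?_
    · have := h2T; rwa [e₁] at this
    · have := h2T'; rwa [e₂] at this
    · have := h2T''; rwa [e₃] at this
    · intro h; exact hTT' (e₁.trans (h.trans e₂.symm))
    · intro h; exact hT''T.symm (e₁.trans (h.trans e₃.symm))
    · intro h; exact hT''T'.symm (e₂.trans (h.trans e₃.symm))
  obtain ⟨δ, hδ, hδdef⟩ := isSquare_Δ_of_splitTwoTorsion hsplit
  -- `δ` is `Γ_F`-fixed, hence in `F`
  have hδfix : ∀ f : AlgebraicClosure F ≃ₐ[F] AlgebraicClosure F, f δ = δ := fun f ↦ by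
    rw [hδdef, map_mul, map_mul, map_mul, map_sub, map_sub, map_sub, hx₁ f, hx₂ f, hx₃ f, map_ofNat]
  obtain ⟨d, hd⟩ := (InfiniteGalois.mem_range_algebraMap_iff_fixed δ).mpr hδfix
  -- `Δ(E_F̄) = algebraMap (Δ W) = algebraMap (−7 (c₆/189)²)`
  have hΔ : ((W.baseChange F).baseChange (AlgebraicClosure F)).Δ = algebraMap F (AlgebraicClosure F) (W.baseChange F).Δ := by
    simp only [baseChange, map_Δ]
  have hΔV : (W.baseChange F).Δ = -7 * ((W.baseChange F).c₆ / 189) ^ 2 := by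
    have hjV : (W.baseChange F).j = -3375 := by simp only [baseChange, map_j, hj]; norm_num
    exact Δ_eq_neg_seven_mul_sq_of_j_eq (W.baseChange F) hjV
  have hu : (W.baseChange F).c₆ / 189 ≠ 0 := by
    have hjV : (W.baseChange F).j = -3375 := by simp only [baseChange, map_j, hj]; norm_num
    exact div_ne_zero (c₆_ne_zero_of_j_eq (W.baseChange F) hjV) (by norm_num)
  -- `algebraMap (−7 u²) = d²` in `F̄`, injectivity of `algebraMap`
  have key : algebraMap F (AlgebraicClosure F) (-7 * ((W.baseChange F).c₆ / 189) ^ 2) = algebraMap F (AlgebraicClosure F) (d ^ 2) := by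
    rw [← hΔV, ← hΔ]
    change ((W.baseChange F).baseChange (AlgebraicClosure F)).toAffine.Δ = _ at hδ
    rw [map_pow, hd, ← hδ]
  have key' : -7 * ((W.baseChange F).c₆ / 189) ^ 2 = d ^ 2 := (algebraMap F (AlgebraicClosure F)).injective key
  refine ⟨d / ((W.baseChange F).c₆ / 189), ?_⟩
  rw [← sq, div_pow, ← key', mul_div_assoc, div_self (pow_ne_zero 2 hu), mul_one]

end Rigidity

/-! ## §3 Over `F ∌ √−7`: the coset moving `√−7` conjugates `π` to `π̄` -/

section Coset

variable (W : WeierstrassCurve ℚ) [W.IsElliptic] (F : Type) [Field F] [CharZero F]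

/-- **The other coset anti-commutes, over any `F ∌ √−7`.** `E = W/ℚ` elliptic with `j = −3375`, `F` of characteristic `0` with
`−7 ∉ F²` (e.g. `F = ℚ_v` for `v` inert or ramified in `ℚ(√−7)`), `π ∈ End_{F̄}(E_F)` with `π² = π − 2` and
`#ker π = #ker(1 − π) = 2`, `N ≤ Γ_F` a subgroup commuting with `π` and `g₀` with `Γ_F = N ∪ N·g₀`. Then
`g₀ • π P = g₀ • P − π (g₀ • P)` (`g₀ π g₀⁻¹ = 1 − π`): otherwise the dichotomy `conj_cmEndo_eq_or` makes `π` `Γ_F`-equivariant,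
contradicting `isSquare_neg_seven_of_cmEndo_equivariant`. [cite: SilvermanATAEC1994, II §2 Thm. 2.2(b) and App. A §3 (row D = -7)] -/
theorem smul_cmEndo_eq_of_coset_of_not_isSquare (hj : W.j = -3375) (h7 : ¬ IsSquare (-7 : F))
    {π : AddMonoid.End (W.baseChange F).geomPoints} (hπ : π ∈ (W.baseChange F).geomEndRing) (hrel : π * π = π - 2)
    (hker : Nat.card (π : (W.baseChange F).geomPoints →+ (W.baseChange F).geomPoints).ker = 2)
    (hker' : Nat.card ((1 - π : AddMonoid.End (W.baseChange F).geomPoints) :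
      (W.baseChange F).geomPoints →+ (W.baseChange F).geomPoints).ker = 2)
    {N : Subgroup (absoluteGaloisGroup F)} (hN : ∀ n ∈ N, ∀ P : (W.baseChange F).geomPoints, n • π P = π (n • P))
    {g₀ : absoluteGaloisGroup F} (hcoset : ∀ g : absoluteGaloisGroup F, g ∈ N ∨ g * g₀⁻¹ ∈ N)
    (P : (W.baseChange F).geomPoints) : g₀ • π P = g₀ • P - π (g₀ • P) := by
  haveI : (W.baseChange F).IsElliptic := inferInstanceAs ((W.map (algebraMap ℚ F)).IsElliptic)
  rcases conj_cmEndo_eq_or (W.baseChange F) hπ hrel g₀ with hcomm | hanti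
  · exfalso
    have hg₀ : ∀ R : (W.baseChange F).geomPoints, g₀ • π R = π (g₀ • R) := fun R ↦ by
      have h := congrArg (fun f : AddMonoid.End (W.baseChange F).geomPoints ↦ f (g₀ • R)) hcomm
      simp only [toAddMonoidEnd_mul_mul_toAddMonoidEnd_inv_apply, inv_smul_smul] at h
      exact h
    refine h7 (isSquare_neg_seven_of_cmEndo_equivariant W F hj hrel hker hker' fun g R ↦ ?_)
    rcases hcoset g with hg | hg
    · exact (hN g hg R).symm
    · obtain ⟨m, hm, rfl⟩ : ∃ m ∈ N, g = m * g₀ := ⟨g * g₀⁻¹, hg, by rw [inv_mul_cancel_right]⟩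
      rw [mul_smul, ← hN m hm, ← hg₀, ← mul_smul]
  · have h := congrArg (fun f : AddMonoid.End (W.baseChange F).geomPoints ↦ f (g₀ • P)) hanti
    simp only [toAddMonoidEnd_mul_mul_toAddMonoidEnd_inv_apply, inv_smul_smul] at h
    have e1 : (1 - π : AddMonoid.End (W.baseChange F).geomPoints) (g₀ • P) = g₀ • P - π (g₀ • P) := by
      change ((1 : AddMonoid.End (W.baseChange F).geomPoints) : _ →+ _) (g₀ • P) - (π : _ →+ _) (g₀ • P) = _
      simp
    rw [e1] at h
    exact h

end Coset

end Summit.BirchSwinnertonDyer.BirchSwinnertonDyer.Theorems.PrintCf2.CMPrimes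

end
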